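import Literature.NumberTheory.Automorphic.AutomorphicRepsGLCuspidalQuasiSimple
import Literature.NumberTheory.Automorphic.AutomorphicRepsGLAnalyticVectorsHolds
import Literature.NumberTheory.Automorphic.AutomorphicRepsGLCuspidalL2Frontier
import Literature.NumberTheory.Automorphic.AutomorphicRepsGLCuspFormsRapidDecaySiegelProofs
import Literature.NumberTheory.Automorphic.HarishChandraStep2GL
import HarnessLib

/-!
# Step 3 of Borel–Jacquet 4.6 for `GL_n` (irreducibility of `V_Π`) and the root fact from the
# four named facts they currently rest on (assembly only; D-0026 review of the split child F3)

Topic `NumberTheory/Automorphic`; sibling proof file of `AutomorphicRepsGLCuspidalL2` (F1–F4 and the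
assembly of `AutomorphicRepsGL.exists_cuspidalRepData_of_L2 hcpt μ`: every irreducible closed invariant
`Π ≤ L²_cusp(GL_n(𝔸_K) ⧸ A_G GL_n(K), μ)` comes from the cuspidal automorphic representation datum
`V_Π / 0`, `V_Π = formsOfL2 hcpt μ Π`; Borel–Jacquet 1979, 4.6; Getz–Hahn 2024, Thm. 6.5.2, printed
p. 121; Bump 1997, Thm. 3.3.4) and of `AutomorphicRepsGLCuspidalL2Frontier` (the root from five leaves).

F3 is `AutomorphicRepsGL.formsOfL2_irreducible hcpt μ`: a `(𝔤, K_∞) × GL_n(𝔸_K^∞)`-stable `W ≤ V_Π` is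
`0` or `V_Π` — Harish-Chandra's correspondence between closed invariant subspaces of an admissible
representation and the submodules of its `K`-finite vectors (Harish-Chandra 1953, Thm. 5, printed
p. 228, which assumes `dim ℌ_𝔇 < ∞` for every `K`-type `𝔇`), for the cuspidal `Π` of Borel–Jacquet
4.6, where admissibility is part of the conclusion (Getz–Hahn 2024, Thm. 6.5.2 with Def. 6.6;
Bump 1997, Thm. 3.3.4). The statement is the irreducibility conjunct of the root fact verbatim (the
root pins `W = V_Π`, `W' = ⊥`), it is printed, and it is not restated here.

This file records, as proved implications only, that F3 — and with it the root — already follows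
from FOUR named facts of the tree, every reduction on the way being a theorem of the tree:

* `AutomorphicRepsGL.formsOfL2_closure_exp_invariant_of_HC`: F3a (the closure of the classes of a
  stable `W ≤ V_Π` is `R(exp X)`-invariant) from Harish-Chandra's convolution identity
  `AutomorphicRepsGL.exists_convolution_eq_self hcpt` ALONE: `cuspidal_bounded_of_exists_convolution_eq_self`
  (`…CuspFormsRapidDecaySiegelProofs`: boundedness of `A_G`-invariant cusp forms) and
  `formsOfL2_closure_exp_invariant_of_bounded` (`…AnalyticVectorsHolds`: analyticity of the `L²`-orbits
  of cusp forms by Nelson's method, then Harish-Chandra's closure theorem).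
* `AutomorphicRepsGL.isAdmissibleGK_cuspidal_levelFixed_of_leaves`: admissibility of `Π^U`
  (`isAdmissibleGK_cuspidal_levelFixed hcpt μ`, the input of Step 3b) from the four leaves, by
  `isAdmissibleGK_cuspidal_levelFixed_of_garding` (`…CuspidalQuasiSimple`) fed with F1 from F1d
  (`formsOfL2_ne_bot_of_infinitesimalCharacter`, `…CuspidalL2Frontier`), F2 from the convolution identity
  (`formsOfL2_isStableSubmodule_of_harishChandra`, `HarishChandraStep2GL`), F3a as above and the
  discharged F1b (`isArchSmooth_smoothedForm_holds`).
* `AutomorphicRepsGL.formsOfL2_mem_of_toLp_mem_closure_of_leaves` (F3b) and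
  `AutomorphicRepsGL.formsOfL2_irreducible_of_leaves` (**F3 from the four leaves**):
  `formsOfL2_mem_of_toLp_mem_closure_of_isAdmissibleGK` (`…CuspidalL2Step3b`) and
  `formsOfL2_irreducible_of` (`…CuspidalL2Step3`).
* `AutomorphicRepsGL.exists_cuspidalRepData_of_L2_of_four`: the root fact from the same four leaves
  (`exists_cuspidalRepData_of_L2_of_harishChandra` of `HarishChandraStep2GL`; F4 is discharged in
  `…CuspidalL2Step4`).

The four leaves (named facts, each with its own residence and printed source; none is introduced or
restated here):

1. `AutomorphicRepsGL.exists_convolution_eq_self hcpt` [`HarishChandraConvolutionGL`] — `φ = φ ∗ α`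
   for automorphic `φ` (Harish-Chandra 1966, Thm. 1; Borel 1972, Thm. 3.18; Borel–Jacquet 1979, 4.3).
2. `AutomorphicRepsGL.exists_infinitesimalCharacter_garding hcpt μ` (F1d) [`…CuspidalL2Step1`] —
   `Z(𝔤)` acts on the Gårding vectors of the irreducible `Π` by a character (Segal–Mautner;
   Getz–Hahn 2024, proof of Thm. 6.5.1, printed p. 192).
3. `AutomorphicRepsGL.exists_testFunction_smoothedVector_eq hcpt μ` [`…CuspidalSpectralExpansion`] —
   every `K_∞`-finite level-fixed `v ∈ Π` is `Π(η) v` (Getz–Hahn 2024, Lemma 9.8.2, printed p. 191;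
   its printed proof, p. 192, uses the admissibility of `Π` and Dixmier–Malliavin).
4. `harishChandra_finiteness_gl hcpt` [`AutomorphicRepsGL`] — Harish-Chandra's finiteness theorem
   (Borel–Jacquet 1979, 4.3 (i); Getz–Hahn 2024, Thm. 6.1).

When these are discharged, `formsOfL2_irreducible_holds` is `formsOfL2_irreducible_of_leaves` applied to
their `_holds`, and likewise for the root. Nothing is defined here; no named fact is introduced; the
axiom closure of every theorem is `{propext, Classical.choice, Quot.sound}`.

## References

* A. Borel, H. Jacquet, *Automorphic forms and automorphic representations*, Proc. Sympos. Pure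
  Math. 33 (Corvallis 1977), Part 1 (1979), 189–202, §4.3, §4.6 [BorelJacquetCorvallis1979] (not held;
  cross-checked against the two books below).
* Harish-Chandra, *Representations of a semisimple Lie group on a Banach space. I*, Trans. AMS 75
  (1953), 185–243: Thm. 5 (p. 228), Thm. 6 (p. 230) [HarishChandraTAMS1953] (held).
* J. R. Getz, H. Hahn, *An Introduction to Automorphic Representations*, GTM 300 (2024): Thm. 4.4.1
  and Prop. 4.4.2 (pp. 81–83), Prop. 4.5.3 (p. 86), Thm. 6.5.2 (p. 121), Lemma 9.8.2 (p. 191) and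
  proof of Thm. 6.5.1 (p. 192) [GetzHahn2024] (held).
* D. Bump, *Automorphic Forms and Representations* (1997), Thm. 3.3.4 and its proof (PDF pp. 296–297)
  [Bump1997] (held).
-/

noncomputable section

open scoped MatrixGroups
open NumberField _root_.MeasureTheory

namespace Literature.NumberTheory.Automorphic

variable {n : ℕ} {K : Type} [Field K] [NumberField K]
  {hcpt : isCompact_glFiniteIntegralLevel n K}
  {μ : Measure (AdelicGroupData.gl n K).automorphicQuotient}
  [(AdelicGroupData.gl n K).IsAutomorphicMeasure μ]

/-- **Step 3a of Borel–Jacquet 4.6 from Harish-Chandra's convolution identity alone.** The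
`L²`-closure of the classes of a `(𝔤, K_∞) × GL_n(𝔸_K^∞)`-stable `W ≤ V_Π` is invariant under
`R(exp X)`, `X ∈ 𝔤`, granted `φ = φ ∗ α` for automorphic `φ`: the identity gives boundedness of
`A_G`-invariant cusp forms (`cuspidal_bounded_of_exists_convolution_eq_self`), whence analyticity of
the `L²`-orbits of cusp forms and Harish-Chandra's closure theorem
(`formsOfL2_closure_exp_invariant_of_bounded`). Harish-Chandra 1953, Cor. to Thm. 2 (p. 211) and
Lemma 34; Borel–Jacquet 1979, 4.6. [cite: HarishChandraTAMS1953, Cor. to Thm. 2 (p. 211)] -/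
theorem AutomorphicRepsGL.formsOfL2_closure_exp_invariant_of_HC
    (hHC : AutomorphicRepsGL.exists_convolution_eq_self hcpt) :
    AutomorphicRepsGL.formsOfL2_closure_exp_invariant hcpt μ :=
  AutomorphicRepsGL.formsOfL2_closure_exp_invariant_of_bounded
    (AutomorphicRepsGL.cuspidal_bounded_of_exists_convolution_eq_self hHC)

/-- **Admissibility of cuspidal `Π^U` from the four leaves.** For an irreducible closed invariant
`Π ≤ L²_cusp(GL_n(𝔸_K) ⧸ A_G GL_n(K), μ)` and a level `U`, `K_∞` acts on `Π^U` with finite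
multiplicities, granted the convolution identity (giving F2 and F3a), F1d (giving F1, and with the
discharged F1b and Lemma 9.8.2 the `Z(𝔤)`-character on `V_Π`), Getz–Hahn's Lemma 9.8.2 and
Harish-Chandra's finiteness theorem (`isAdmissibleGK_cuspidal_levelFixed_of_garding`).
Harish-Chandra 1953, Thm. 6 (p. 230); Getz–Hahn 2024, Thm. 6.5.2; Bump 1997, Thm. 3.3.4. [cite: HarishChandraTAMS1953, Thm. 6 (p. 230)] -/
theorem AutomorphicRepsGL.isAdmissibleGK_cuspidal_levelFixed_of_leaves
    (hHC : AutomorphicRepsGL.exists_convolution_eq_self hcpt)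
    (h1d : AutomorphicRepsGL.exists_infinitesimalCharacter_garding hcpt μ)
    (h₉ : AutomorphicRepsGL.exists_testFunction_smoothedVector_eq hcpt μ)
    (hfin : harishChandra_finiteness_gl hcpt) :
    AutomorphicRepsGL.isAdmissibleGK_cuspidal_levelFixed hcpt μ :=
  AutomorphicRepsGL.isAdmissibleGK_cuspidal_levelFixed_of_garding
    (AutomorphicRepsGL.formsOfL2_ne_bot_of_infinitesimalCharacter h1d)
    (AutomorphicRepsGL.formsOfL2_isStableSubmodule_of_harishChandra hHC)
    (AutomorphicRepsGL.formsOfL2_closure_exp_invariant_of_HC hHC)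
    (AutomorphicRepsGL.isArchSmooth_smoothedForm_holds hcpt μ) h1d h₉ hfin

/-- **Step 3b of Borel–Jacquet 4.6 from the four leaves**: for a stable `W ≤ V_Π`, an element of
`V_Π` whose class lies in the `L²`-closure of the classes of `W` lies in `W` (`Cl[W] ∩ V_Π = W`), by
`formsOfL2_mem_of_toLp_mem_closure_of_isAdmissibleGK` and the admissibility just assembled.
Harish-Chandra 1953, Thm. 5 (p. 228); Libine 2012, Lemma 74. [cite: HarishChandraTAMS1953, Thm. 5 (p. 228)] -/
theorem AutomorphicRepsGL.formsOfL2_mem_of_toLp_mem_closure_of_leaves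
    (hHC : AutomorphicRepsGL.exists_convolution_eq_self hcpt)
    (h1d : AutomorphicRepsGL.exists_infinitesimalCharacter_garding hcpt μ)
    (h₉ : AutomorphicRepsGL.exists_testFunction_smoothedVector_eq hcpt μ)
    (hfin : harishChandra_finiteness_gl hcpt) :
    AutomorphicRepsGL.formsOfL2_mem_of_toLp_mem_closure hcpt μ :=
  AutomorphicRepsGL.formsOfL2_mem_of_toLp_mem_closure_of_isAdmissibleGK
    (AutomorphicRepsGL.isAdmissibleGK_cuspidal_levelFixed_of_leaves hHC h1d h₉ hfin)

/-- **Step 3 of Borel–Jacquet 4.6 for `GL_n` (irreducibility of `V_Π`) from the four leaves.** For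
an irreducible closed invariant `Π ≤ L²_cusp(GL_n(𝔸_K) ⧸ A_G GL_n(K), μ)`, the
`(𝔤, K_∞) × GL_n(𝔸_K^∞)`-module `V_Π = formsOfL2 hcpt μ Π` has no stable subspace other than `0` and
`V_Π`, granted Harish-Chandra's convolution identity, F1d, Getz–Hahn's Lemma 9.8.2 and
Harish-Chandra's finiteness theorem: `formsOfL2_irreducible_of` (Harish-Chandra's correspondence,
`…CuspidalL2Step3`) with F3a from the convolution identity and F3b from the four leaves.
Harish-Chandra 1953, Thm. 5 (p. 228); Borel–Jacquet 1979, 4.6; Getz–Hahn 2024, Thm. 6.5.2 (p. 121).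
[cite: HarishChandraTAMS1953, Thm. 5 (p. 228)] -/
theorem AutomorphicRepsGL.formsOfL2_irreducible_of_leaves
    (hHC : AutomorphicRepsGL.exists_convolution_eq_self hcpt)
    (h1d : AutomorphicRepsGL.exists_infinitesimalCharacter_garding hcpt μ)
    (h₉ : AutomorphicRepsGL.exists_testFunction_smoothedVector_eq hcpt μ)
    (hfin : harishChandra_finiteness_gl hcpt) :
    AutomorphicRepsGL.formsOfL2_irreducible hcpt μ :=
  AutomorphicRepsGL.formsOfL2_irreducible_of
    (AutomorphicRepsGL.formsOfL2_closure_exp_invariant_of_HC hHC)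
    (AutomorphicRepsGL.formsOfL2_mem_of_toLp_mem_closure_of_leaves hHC h1d h₉ hfin)

/-- **Borel–Jacquet 1979, 4.6 for `GL_n` from the four leaves.** Every irreducible closed invariant
subspace of `L²_cusp(GL_n(𝔸_K) ⧸ A_G GL_n(K), μ)` comes from the cuspidal automorphic representation
datum `V_Π / 0` (`AutomorphicRepsGL.exists_cuspidalRepData_of_L2 hcpt μ`), granted Harish-Chandra's
convolution identity, F1d, Getz–Hahn's Lemma 9.8.2 and Harish-Chandra's finiteness theorem:
`exists_cuspidalRepData_of_L2_of_harishChandra` (F1 from F1d, F2 from the convolution identity, F4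
discharged) with F3 from the four leaves. Borel–Jacquet 1979, 4.6; Getz–Hahn 2024, Thm. 6.5.2
(p. 121); Bump 1997, Thm. 3.3.4. [cite: BorelJacquetCorvallis1979, 4.6] -/
theorem AutomorphicRepsGL.exists_cuspidalRepData_of_L2_of_four
    (hHC : AutomorphicRepsGL.exists_convolution_eq_self hcpt)
    (h1d : AutomorphicRepsGL.exists_infinitesimalCharacter_garding hcpt μ)
    (h₉ : AutomorphicRepsGL.exists_testFunction_smoothedVector_eq hcpt μ)
    (hfin : harishChandra_finiteness_gl hcpt) :
    AutomorphicRepsGL.exists_cuspidalRepData_of_L2 hcpt μ :=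
  AutomorphicRepsGL.exists_cuspidalRepData_of_L2_of_harishChandra
    (AutomorphicRepsGL.formsOfL2_ne_bot_of_infinitesimalCharacter h1d) hHC
    (AutomorphicRepsGL.formsOfL2_irreducible_of_leaves hHC h1d h₉ hfin)

end Literature.NumberTheory.Automorphic
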